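import Summits.AtomisticToContinuum.HydrodynamicLimit.Theorems.BoxDissipativeWeakStrongRelativeEnergyStabilityGronwallStrong
import Summits.AtomisticToContinuum.HydrodynamicLimit.Theorems.BoxDissipativeWeakStrongRelativeEnergyStabilityDefs
import Summits.AtomisticToContinuum.HydrodynamicLimit.Theorems.BoxDissipativeWeakStrongEntropyAdmissibilityStubDynPartIntegrable
import Literature.Analysis.FluidPDE.MVRelativeEnergyInequality
import Literature.Analysis.FluidPDE.HardSphereFlowJointMeasurable
import Literature.MathematicalPhysics.KineticTheory.HardSphereBBGKYLiouvilleFlow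
import Literature.MathematicalPhysics.KineticTheory.HardSphereEulerProofs
import HarnessLib

/-!
# Crux `RelativeEnergyStability` (stmt-AtomisticToContinuum-17653), line `registered`, heart stub S-X —
# helper package A: time-integrability along a good orbit (`sx_integrableOn_ent`, `sx_integrableOn_pt`)

Two registered sub-goals of the heart stub S-X (pathwise layer of the Březina–Feireisl bookkeeping run along
the orbit `s ↦ Φ_s z` of a GOOD datum `z` of the hard-sphere flow):

* `sx_integrableOn_ent` — the K2 (entropy-balance) integrand tested with `φ := θ`,
  `s ↦ ∫ (ρ̂ Z_{a,b}(ŝ) ∂ₜθ + Z_{a,b}(ŝ) m̂·∇θ)(s, x) dx`, is integrable on `(0, t]`, `t < T`.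
  Proof: integrable = jointly measurable + bounded on a set of finite measure (`ia_integrableOn_Ioc_integral`,
  a variant of `FluxClosureB4.integrableOn_Ioc_integral` asking for the identification only on `(0, t]`).
  The integrand is DEFINITIONALLY the static bulk functional `EABirthS1a.statBulk` of the
  `EntropyAdmissibility` line (same box kernel, same cut entropy, same box temperature, `clamp a b = max a (min · b)`),
  whose joint measurability in `((s, w), x)` is `EABirthS1a.measurable_statBulk` / `measurable_statEntropy`
  (the `limsup`-defined excess free energy is only read on `[0, η₁] ⊆ [0, η₀)` where it is continuous); the
  orbit of a good datum is measurable (`HardSphereFlow.measurable_flow_prod_torus`); the test data `∂ₜθ`, `∇θ`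
  are clamped in time to `[0, t]` (invisible on `(0, t]`, jointly measurable by `EABirthS1a.measurable_clampTime`);
  the bound `A₀ + B₀ E(Φ_s z) = A₀ + B₀ E(z)` is `EABirthS1a.exists_abs_statBulk_le` plus conservation of
  energy on good orbits (`HardSphereFlow.configEnergy_flow`).
* `sx_integrableOn_pt` — under the strong-side conjunction `S` of `…GronwallStrong`: a uniform bound
  `|∂ₜp_cut(ρ,θ)| ≤ Np` on `[0,t] × 𝕋³`, integrability of `s ↦ ∫ ∂ₜp_cut dx` on `(0,t]`, and `x`-integrability
  of `∂ₜp_cut(s,·)` for every `s ∈ [0,T)`. Proof: along the solution the cut law has the coefficients of the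
  smooth band extension `eosB` (`sx_pd_transfer`), for which `IsClassicalEulerSolution.exists_coeffBound` bounds
  `∂ₜp`, `continuousOn_coeffs` gives joint continuity on `(0,T) × 𝕋³` (Fubini: `Integrable.integral_prod_left`),
  and the slice `x ↦ ∂ₜp(s,x)` is continuous (`continuousOn_deriv_slice_fst/snd` through the smooth slices).

References: BrezinaFeireisl2018 §3.1–3.2 (the bookkeeping these integrability facts serve); measure theory only.
-/

noncomputable section

namespace Summit.AtomisticToContinuum.HydrodynamicLimit.Theorems.RES

open MeasureTheory Filter Set Function
open scoped Topology InnerProductSpace ENNReal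
open Summit.AtomisticToContinuum.HydrodynamicLimit.Theses.BoxDissipativeWeakStrong
open Literature.MathematicalPhysics.KineticTheory Literature.Analysis.FluidPDE Literature.Analysis.FunctionSpaces
open Literature.Analysis.FluidPDE.CompressibleEuler
open Literature.Analysis.FluidPDE.CompressibleEuler.EulerPhase
open Literature.Analysis.FluidPDE.CompressibleEuler.StrongPointData

/-- Parametric integrals over the torus, identification on `(0, τ]` only: if `F s x = G (s, x)` for
`s ∈ (0, τ]` with `G` jointly measurable and bounded on `[0, τ] × 𝕋³`, then `s ↦ ∫ F s x dx` is integrable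
on `(0, τ]` (variant of `FluxClosureB4.integrableOn_Ioc_integral`). -/
theorem ia_integrableOn_Ioc_integral {F : ℝ → T3 → ℝ} {G : ℝ × T3 → ℝ} {τ C : ℝ}
    (hG : Measurable G) (hFG : ∀ s ∈ Ioc 0 τ, ∀ x, F s x = G (s, x))
    (hC : ∀ p : ℝ × T3, p.1 ∈ Icc 0 τ → |G p| ≤ C) : IntegrableOn (fun s => ∫ x, F s x) (Ioc 0 τ) := by
  have hgi : IntegrableOn (fun s => ∫ x, G (s, x)) (Ioc 0 τ) := by
    refine Measure.integrableOn_of_bounded (M := C) measure_Ioc_lt_top.ne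
      (hG.stronglyMeasurable.integral_prod_right' (ν := volume)).measurable.aestronglyMeasurable ?_
    filter_upwards [ae_restrict_mem measurableSet_Ioc] with s hs
    have h := norm_integral_le_of_norm_le_const (μ := (volume : Measure T3)) (f := fun x => G (s, x))
      (C := C) (ae_of_all _ fun x => by rw [Real.norm_eq_abs]; exact hC (s, x) ⟨hs.1.le, hs.2⟩)
    rwa [probReal_univ, mul_one] at h
  refine hgi.congr_fun (fun s hs => ?_) measurableSet_Ioc
  exact integral_congr_ae (ae_of_all _ fun x => (hFG s hs x).symm)

/-- **(A1) `sx_integrableOn_ent`.** Time-integrability on `(0, t]` of the K2 integrand tested with `φ := θ` along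
the orbit of a good datum: `s ↦ ∫ (ρ̂ Z_{a,b}(ŝ) ∂ₜθ + Z_{a,b}(ŝ) m̂·∇θ)(s,x) dx` (box fields of `Φ_s z` at window
`l`, cut entropy `ŝ = s_cut(ρ̂, θ̂)`, clamp `Z_{a,b} = max a (min · b)`). -/
theorem sx_integrableOn_ent {η₀ : ℝ} (hcont : ContinuousOn hsExcessFreeEnergy (Ico 0 η₀)) {σ η₁ T : ℝ}
    (hσ : 0 < σ) (hη₁ : 0 < η₁) (hη₁₀ : η₁ < η₀) {ρ θ : ℝ → T3 → ℝ} {u : ℝ → T3 → V3}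
    (hsol : IsHardSphereEulerSolution σ T ρ u θ) {N : ℕ}
    (Φ : HardSphereFlow (Literature.Analysis.FluidPDE.Torus.geometry (Fin 3)) (hsDiameter σ N) (N + 1))
    {l : ℝ} (hl : 0 < l) {z : Config (N + 1) (Fin 3) T3} (hz : z ∈ Φ.good) {a b : ℝ} (hab : a ≤ b)
    {t : ℝ} (ht : t ∈ Ico 0 T) :
    IntegrableOn (fun s => ∫ x,
      ((boxState l (Φ.flow s z) x).1 *
            max a (min ((cutEOS σ η₁).s (boxState l (Φ.flow s z) x).1
              (2 / 3 * ((boxState l (Φ.flow s z) x).2.2 / (boxState l (Φ.flow s z) x).1 -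
                ‖(boxState l (Φ.flow s z) x).2.1‖ ^ 2 / (2 * (boxState l (Φ.flow s z) x).1 ^ 2)))) b) *
          Torus.timeDerivWithin (Ico 0 T) θ s x +
        max a (min ((cutEOS σ η₁).s (boxState l (Φ.flow s z) x).1
              (2 / 3 * ((boxState l (Φ.flow s z) x).2.2 / (boxState l (Φ.flow s z) x).1 -
                ‖(boxState l (Φ.flow s z) x).2.1‖ ^ 2 / (2 * (boxState l (Φ.flow s z) x).1 ^ 2)))) b) *
          inner ℝ (boxState l (Φ.flow s z) x).2.1 (Torus.gradient (θ s) x))) (Ioc 0 t) := by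
  have hIcc : Icc 0 t ⊆ Ico 0 T := fun s hs => ⟨hs.1, hs.2.trans_lt ht.2⟩
  have hS : UniqueDiffOn ℝ (Ico 0 T) := uniqueDiffOn_Ico 0 T
  have hcl : ∀ s : ℝ, max 0 (min s t) ∈ Icc 0 t := fun s => ⟨le_max_left _ _, max_le ht.1 (min_le_right _ _)⟩
  -- joint measurability of the static bulk functional with time-clamped test data, along the orbit
  have hm₁ : Measurable fun q : ℝ × T3 => Torus.timeDerivWithin (Ico 0 T) θ (max 0 (min q.1 t)) q.2 :=
    EABirthS1a.measurable_clampTime (hsol.smooth_temperature.timeDerivWithin hS).continuousOn_stLift ht.1 hIcc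
  have hm₂ : Measurable fun q : ℝ × T3 => Torus.gradient (θ (max 0 (min q.1 t))) q.2 :=
    EABirthS1a.measurable_clampTime (u := fun s => Torus.gradient (θ s))
      (hsol.smooth_temperature.gradient hS).continuousOn_stLift ht.1 hIcc
  have hbulk := EABirthS1a.measurable_statBulk
    (ψ₁ := fun s x => Torus.timeDerivWithin (Ico 0 T) θ (max 0 (min s t)) x)
    (ψ₂ := fun s x => Torus.gradient (θ (max 0 (min s t))) x)
    (EABirthS1a.measurable_statEntropy (N := N) hcont hσ.le hη₁.le hη₁₀ hl.le a b) hm₁ hm₂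
  have hγ : Measurable fun s : ℝ => Φ.flow s z :=
    Φ.measurable_flow_prod_torus.comp ((measurable_const (a := (⟨z, hz⟩ : Φ.good))).prodMk measurable_id)
  have hπ : Measurable fun p : ℝ × T3 => ((p.1, Φ.flow p.1 z), p.2) :=
    (measurable_fst.prodMk (hγ.comp measurable_fst)).prodMk measurable_snd
  -- sup bounds of the test data on `[0, t] × 𝕋³`, and the bound along the orbit (energy conservation)
  obtain ⟨D, hD⟩ := (hsol.smooth_temperature.timeDerivWithin hS).exists_norm_le_of_isCompact isCompact_Icc hIcc
  obtain ⟨Gs, hGs⟩ := (hsol.smooth_temperature.gradient hS).exists_norm_le_of_isCompact isCompact_Icc hIcc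
  obtain ⟨A₀, B₀, hAB⟩ := EABirthS1a.exists_abs_statBulk_le (N := N) (σ := σ) (η₁ := η₁) hab hl.le
    (ψ₁ := fun s x => Torus.timeDerivWithin (Ico 0 T) θ (max 0 (min s t)) x)
    (ψ₂ := fun s x => Torus.gradient (θ (max 0 (min s t))) x)
    (fun s x => hD _ (hcl s) x) (fun s x => hGs _ (hcl s) x)
  refine ia_integrableOn_Ioc_integral (C := A₀ + B₀ * configEnergy z) (hbulk.comp hπ) (fun s hs x => ?_)
    (fun p _ => ?_)
  · simp only [Function.comp_apply, EABirthS1a.statBulk, min_eq_left hs.2, max_eq_right hs.1.le]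
    rfl
  · rw [Function.comp_apply, ← Φ.configEnergy_flow hz p.1]
    exact hAB p.1 _ p.2

/-- **(A3) `sx_integrableOn_pt`.** Under the strong-side conjunction `S`: a uniform bound `|∂ₜp_cut(ρ,θ)| ≤ Np` on
`[0,t] × 𝕋³`, integrability of `s ↦ ∫ ∂ₜp_cut(ρ,θ)(s,x) dx` on `(0,t]`, and `x`-integrability of `∂ₜp_cut(s,·)` for
every `s ∈ [0,T)` (the cut law has the coefficients of the smooth band extension along the solution). -/
theorem sx_integrableOn_pt {η₀ η₁ η₁B σ T : ℝ} {F χ f : ℝ → ℝ} {ρ θ : ℝ → T3 → ℝ} {u : ℝ → T3 → V3}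
    (S : AnalyticOnNhd ℝ F (Ioo (-η₀) η₀) ∧ EqOn hsExcessFreeEnergy F (Ico 0 η₀) ∧ 0 < η₁ ∧ η₁ ≤ η₁B ∧
      2 * η₁B < η₀ ∧ 0 < σ ∧
      (∀ x, 0 < x → x * σ ^ 3 ≤ η₁B → f x = hsExcessFreeEnergy (x * σ ^ 3) ∧ χ x = hsCompressibility (x * σ ^ 3)) ∧
      (EulerEOS.monatomicExcess χ f).IsGibbs ∧ IsHardSphereEulerSolution σ T ρ u θ ∧
      ∀ t ∈ Ico 0 T, ∀ x, ρ t x * σ ^ 3 ≤ η₁ / 2)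
    {t : ℝ} (ht : t ∈ Ico 0 T) :
    ∃ Np : ℝ, (∀ s ∈ Icc 0 t, ∀ x, |(pdAt T ρ u θ (s, x)).pt (cutEOS σ η₁)| ≤ Np) ∧
      IntegrableOn (fun s => ∫ x, (pdAt T ρ u θ (s, x)).pt (cutEOS σ η₁)) (Ioc 0 t) ∧
      ∀ s ∈ Ico 0 T, Integrable (fun x => (pdAt T ρ u θ (s, x)).pt (cutEOS σ η₁)) := by
  have hB : IsClassicalEulerSolution (EulerEOS.monatomicExcess χ f) T ρ u θ := sx_sol_B S
  have hGB : (EulerEOS.monatomicExcess χ f).IsGibbs := S.2.2.2.2.2.2.2.1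
  have hS : UniqueDiffOn ℝ (Ico 0 T) := uniqueDiffOn_Ico 0 T
  have hIcc : Icc 0 t ⊆ Ico 0 T := fun s hs => ⟨hs.1, hs.2.trans_lt ht.2⟩
  -- transfer `∂ₜp_cut = ∂ₜp_B` along the solution
  have hptB : ∀ s ∈ Ico 0 T, ∀ x, (pdAt T ρ u θ (s, x)).pt (cutEOS σ η₁) =
      (pdAt T ρ u θ (s, x)).pt (EulerEOS.monatomicExcess χ f) :=
    fun s hs x => ((sx_pd_transfer S) hs x).2.2.2.2.2.2.2.1
  -- the uniform bound on `[0, t] × 𝕋³`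
  obtain ⟨M, hM0, hBM⟩ := hB.exists_bound_pointData ht.2
  obtain ⟨Np, hNp⟩ := hB.exists_coeffBound hGB ht.1 ht.2 hM0 hBM
  have hN : ∀ s ∈ Icc 0 t, ∀ x, |(pdAt T ρ u θ (s, x)).pt (cutEOS σ η₁)| ≤ Np := fun s hs x => by
    rw [hptB s (hIcc hs) x]; exact (hNp s hs x).2.2.2.1
  -- continuity of the `x`-slices on `[0, T)`
  have hx : ∀ s ∈ Ico 0 T, Continuous fun x => (pdAt T ρ u θ (s, x)).pt (EulerEOS.monatomicExcess χ f) := by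
    intro s hs
    have cr : Continuous (ρ s) := (hB.smooth_density.isSmooth_slice hs).continuous
    have cΘ : Continuous (θ s) := (hB.smooth_temperature.isSmooth_slice hs).continuous
    have crt : Continuous (Torus.timeDerivWithin (Ico 0 T) ρ s) :=
      ((hB.smooth_density.timeDerivWithin hS).isSmooth_slice hs).continuous
    have cΘt : Continuous (Torus.timeDerivWithin (Ico 0 T) θ s) :=
      ((hB.smooth_temperature.timeDerivWithin hS).isSmooth_slice hs).continuous
    have hpair : Continuous fun x => (ρ s x, θ s x) := cr.prodMk cΘ
    have hmaps : ∀ x, (ρ s x, θ s x) ∈ Ioi (0 : ℝ) ×ˢ Ioi (0 : ℝ) := fun x =>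
      ⟨hB.density_pos s hs x, hB.temperature_pos s hs x⟩
    have cpρ := (continuousOn_deriv_slice_fst hGB.1 isOpen_quadrant le_rfl).comp_continuous hpair hmaps
    have cpϑ := (continuousOn_deriv_slice_snd hGB.1 isOpen_quadrant le_rfl).comp_continuous hpair hmaps
    simp only [StrongPointData.pt, StrongPointData.pρ, StrongPointData.pϑ]
    exact (cpρ.mul crt).add (cpϑ.mul cΘt)
  refine ⟨Np, hN, ?_, fun s hs => ?_⟩
  · -- joint continuity on `(0,T) × 𝕋³`, bounded on `(0,t) × 𝕋³`: Fubini
    set g : ℝ × T3 → ℝ := fun q => (pdAt T ρ u θ q).pt (EulerEOS.monatomicExcess χ f) with hg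
    have hc : ContinuousOn g (Ioo 0 T ×ˢ univ) := (hB.continuousOn_coeffs hGB).2.2.1
    have hmeasS : MeasurableSet (Ioo (0 : ℝ) t ×ˢ (univ : Set T3)) := measurableSet_Ioo.prod MeasurableSet.univ
    have hSsub : Ioo (0 : ℝ) t ×ˢ (univ : Set T3) ⊆ Ioo 0 T ×ˢ univ :=
      prod_mono (Ioo_subset_Ioo_right ht.2.le) subset_rfl
    have hint : IntegrableOn g (Ioo 0 t ×ˢ univ) volume := by
      refine IntegrableOn.of_bound ?_ ((hc.mono hSsub).aestronglyMeasurable hmeasS) Np ?_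
      · rw [Measure.volume_eq_prod, Measure.prod_prod]
        exact ENNReal.mul_lt_top measure_Ioo_lt_top (measure_lt_top _ _)
      · rw [ae_restrict_iff' hmeasS]
        exact Eventually.of_forall fun q hq => by
          rw [Real.norm_eq_abs, hg]
          have h := (hNp q.1 ⟨hq.1.1.le, hq.1.2.le⟩ q.2).2.2.2.1
          exact h
    have hint' : Integrable g ((volume.restrict (Ioo (0 : ℝ) t)).prod (volume : Measure T3)) := by
      rw [Measure.restrict_prod_eq_prod_univ, ← Measure.volume_eq_prod]; exact hint
    have h3 : IntegrableOn (fun s => ∫ x, g (s, x)) (Ioo 0 t) := hint'.integral_prod_left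
    have h4 : IntegrableOn (fun s => ∫ x, g (s, x)) (Ioc 0 t) :=
      (integrableOn_Ioc_iff_integrableOn_Ioo enorm_ne_top).2 h3
    refine h4.congr_fun (fun s hs => integral_congr_ae (ae_of_all _ fun x => ?_)) measurableSet_Ioc
    show g (s, x) = (pdAt T ρ u θ (s, x)).pt (cutEOS σ η₁)
    rw [hg, hptB s ⟨hs.1.le, hs.2.trans_lt ht.2⟩ x]
  · have h := (hx s hs).integrable_of_hasCompactSupport (μ := (volume : Measure T3))
      (HasCompactSupport.of_compactSpace _)
    exact h.congr (ae_of_all _ fun x => (hptB s hs x).symm)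

end Summit.AtomisticToContinuum.HydrodynamicLimit.Theorems.RES

end
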